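import Literature.MathematicalPhysics.QuantumFieldTheory.Balaban1983to89.B3Sect3VectorSelfEnergy

/-!
# `Balaban1983to89.B3CxiPropagator` — T. Bałaban, *(Higgs)₂,₃ quantum fields in a finite volume. III. Renormalization*,
Commun. Math. Phys. **88** (1983) 411–445 [Balaban1983Higgs3], p. 437 [PDF 27]: the free propagator
**C^ξ = (−Δ^ξ + 1)^{−1}** of (3.16) on the lattice ξℤ^d — the lattice equation *"−Δ^ξC^ξ = δ^ξ − C^ξ"* PROVED from the
momentum integral, and its consequences by the position-space Neumann (random-walk) series: C^ξ ≥ 0, Σ_y ξ^dC^ξ(y) = 1,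
summability with polynomial weights

statement-level skeleton of published theorems with citation tags; proofs where landed; nothing here is a claim about the Yang–Mills mass gap

PDF held: `paper:balaban1983-higgs-2-3-quantum-fields-finite-volume` (journal page = PDF page + 410).  Read: p. 437 [PDF 27] on the ×2
render `run/shared/lean/pub/pub-balaban/b2b-balaban-ref1/pages/1983-cmp88-higgs23-III/1983-cmp88-higgs23-III-p027-x2.png`; p. 441
[PDF 31] ((3.27)).

CITATION HEADER (lean-in-tree rule).  Part of the lit-balaban TYPED SKELETON (HOME `run/shared/lean/pub/lit-balaban/`), reader/typer
seat r15 (fold owner of B3), generation 4; companion of `B3Sect3VectorSelfEnergy` (same seat: §6 there types C^ξ by its momentum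
integral `Cxi` and the displays (3.24)/(3.27)/(3.28) on ξℤ^d).  WHAT IS REPRODUCED: the p. 437 sentence on C^ξ inside row
**B3.Eq3.11-3.17** of `HOME/lit-balaban-r15/ROWS-B3.md`, and the convergence bookkeeping ("T5" of the companion file) that row
**B3.Eq3.25-3.32**'s display (3.27) needs for the infinitely supported kernel C^ξ (used by the sibling `B3Eq327Cxi`).

THE PRINTED TEXT (verbatim, p. 437 [PDF 27]).  *"For simplicity let us denote L^{−j″} = ξ. Next we replace G^ξ_{j″}(0) by
C^ξ = (−Δ^ξ + 1)^{−1}: G^ξ_{j″}(0) = C^ξ + G^ξ_{j″}(0)(1 − m²_{j″} − a_{j″}P_{j″})C^ξ. We have Σ_{ν=1}^d ∂^ξ_νC^ξ∂^{ξ*}_ν = −Δ^ξC^ξ = δ^ξ − C^ξ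
and δ^ξ(y′ − y)(y′_μ − y_μ) = 0, so the expression is equal to … (3.16). Using the inequalities |C^ξ(y − y′)| ≦ O(1)e^{−½|y−y′|}/|y − y′|,
|G^ξ_{j″}(0; y, y′)| ≦ O(1)e^{−δ₀|y−y′|}/|y − y′|, and the corresponding inequalities for derivatives, we can estimate (3.16) by a
constant."*

WHAT IS TYPED / PROVED, and how.  C^ξ is the companion's `Cxi d ξ` (p. 441: the momentum integral
C^ξ(y) = (2π)^{−d}∫_{|p|≤π/ξ} cos(ξp·y)/(Δ^ξ(p) + 1) dp, kernel with respect to Σ_{y′}ξ^d, integer site coordinates y ∈ ℤ^d).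
§1 the lattice operators on ξℤ^d: −Δ^ξ (`negLapZ`) and the identity Σ_ν ∂^ξ_ν∂^{ξ*}_ν = −Δ^ξ of the printed sentence
(`sum_pdiffZ_pdiffAdjZ`).  §2 the Brillouin box |p_μ| ≤ π/ξ as a product of intervals, its volume (2π/ξ)^d, integrability of the
continuous integrands.  §3 ORTHOGONALITY ∫_{|p|≤π/ξ} cos(ξp·y) dp = (2π/ξ)^d·[y = 0] for y ∈ ℤ^d (product of the one-dimensional
integrals ∫_{−π/ξ}^{π/ξ} e^{iξty_μ}dt via `integral_fintype_prod_eq_prod`, e^{iπn} = e^{−iπn}).  §4 **the lattice equation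
(−Δ^ξ + 1)C^ξ = δ^ξ PROVED** (`negLapZ_Cxi_add`: Σ_μ ξ^{−2}(2C^ξ(y) − C^ξ(y+e_μ) − C^ξ(y−e_μ)) + C^ξ(y) = ξ^{−d}[y = 0], δ^ξ = the
lattice δ-function ξ^{−d}1_{y=0} of the volume element ξ^d; from cos(θ + ξp_μ) + cos(θ − ξp_μ) = 2cos θ cos ξp_μ, so that the
integrand becomes (Δ^ξ(p) + 1)cos(ξp·y)/(Δ^ξ(p) + 1), and §3), with the printed form `sum_pdiffZ_Cxi_pdiffAdjZ`
(Σ_ν ∂^ξ_νC^ξ∂^{ξ*}_ν = δ^ξ − C^ξ), and the a-priori bound |C^ξ(y)| ≤ ξ^{−d} (`abs_Cxi_le`).  §5 the nearest-neighbour walk counts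
W_k(y) (`walkCount`: W₀ = 1_{0}, W_{k+1} = Σ_μ(W_k(· + e_μ) + W_k(· − e_μ))) — nonnegative, ≤ (2d)^k, supported in |y|₁ ≤ k,
Σ_yW_k(y) = (2d)^k.  §6 the Neumann series K(y) = βξ^{−d}Σ_kθ^kW_k(y), θ = (2d + ξ²)^{−1}, β = ξ²θ = 1 − 2dθ (`neumannK`): it solves
the lattice equation in the fixed-point form K = θ·Σ_μ(K(·+e_μ) + K(·−e_μ)) + βξ^{−d}1_{0} and 0 ≤ K ≤ ξ^{−d}.  §7 UNIQUENESS of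
bounded solutions of that fixed-point equation (sup-contraction with ratio 2dθ < 1) ⇒ **C^ξ = K** (`Cxi_eq_neumannK`), hence
**C^ξ ≥ 0** (`Cxi_nonneg`), **Σ_y ξ^dC^ξ(y) = 1** (`tsum_Cxi`) and **Σ_y (1 + |y|₁)^m C^ξ(y) < ∞ for every m** (`summable_weight_Cxi`;
Tonelli over (k, y) against Σ_k(1 + k)^m(2dθ)^k < ∞).  NOT CLAIMED: the printed uniform bound |C^ξ(y−y′)| ≤ O(1)e^{−½|y−y′|}/|y−y′|
(d = 3) — the Neumann series gives only the lattice-scale geometric decay rate −log(2d/(2d + ξ²)), not uniform in ξ; that bound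
stays a hypothesis where used (`B3Ineq313Pointwise`, seat p20).  Unit `lit-balaban-r15` (literature-prover-lit-balaban-r15-g4-0),
2026-08-21.
-/

open scoped BigOperators
open MeasureTheory

namespace Literature.MathematicalPhysics.QuantumFieldTheory.Balaban1983to89.B3CxiPropagator

open B3Sect3VectorSelfEnergy

noncomputable section

variable {d : ℕ}

/-! ## 1. The lattice operators on ξℤ^d -/

section Operators

/-- −Δ^ξ on ξℤ^d (integer site coordinates): (−Δ^ξf)(y) = Σ_μ ξ^{−2}(2f(y) − f(y + e_μ) − f(y − e_μ)).
[cite: Balaban1983Higgs3, (3.16) p.437] -/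
def negLapZ (ξ : ℝ) (f : ZSite d → ℝ) : ZSite d → ℝ :=
  fun y => ∑ μ : Fin d, ξ⁻¹ ^ 2 * (2 * f y - f (y + unitVec μ) - f (y - unitVec μ))

/-- the nearest-neighbour hopping sum (Hf)(y) = Σ_μ (f(y + e_μ) + f(y − e_μ)). [cite: Balaban1983Higgs3, (3.16) p.437] -/
def hop (f : ZSite d → ℝ) : ZSite d → ℝ :=
  fun y => ∑ μ : Fin d, (f (y + unitVec μ) + f (y - unitVec μ))

/-- p. 437, verbatim: *"We have Σ_{ν=1}^d ∂^ξ_νC^ξ∂^{ξ*}_ν = −Δ^ξC^ξ"* — PROVED as the operator identity behind it on ξℤ^d: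
Σ_ν ∂^ξ_ν(∂^{ξ*}_νf) = −Δ^ξf for every f (for the translation-invariant kernel C^ξ the kernel of ∂^ξ_νC^ξ∂^{ξ*}_ν is
∂^ξ_ν∂^{ξ*}_νC^ξ). [cite: Balaban1983Higgs3, (3.16) p.437] -/
theorem sum_pdiffZ_pdiffAdjZ (ξ : ℝ) (f : ZSite d → ℝ) (y : ZSite d) :
    ∑ ν : Fin d, pdiffZ ξ⁻¹ ν (pdiffAdjZ ξ⁻¹ ν f) y = negLapZ ξ f y := by
  unfold negLapZ pdiffZ pdiffAdjZ
  refine Finset.sum_congr rfl fun ν _ => ?_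
  rw [add_sub_cancel_right]
  ring

/-- kernel: −Δ^ξf = ξ^{−2}(2d·f − Hf). [cite: Balaban1983Higgs3, (3.16) p.437] -/
theorem negLapZ_eq_hop (ξ : ℝ) (f : ZSite d → ℝ) (y : ZSite d) :
    negLapZ ξ f y = ξ⁻¹ ^ 2 * (2 * d * f y - hop f y) := by
  unfold negLapZ hop
  rw [← Finset.mul_sum]
  congr 1
  have h : ∀ μ : Fin d, 2 * f y - f (y + unitVec μ) - f (y - unitVec μ) =
      2 * f y - (f (y + unitVec μ) + f (y - unitVec μ)) := fun μ => by ring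
  simp_rw [h]
  rw [Finset.sum_sub_distrib, Finset.sum_const, Finset.card_univ, Fintype.card_fin, nsmul_eq_mul]
  ring

/-- kernel: the hopping sum is additive. [folklore] -/
private theorem hop_add (f g : ZSite d → ℝ) (y : ZSite d) : hop (f + g) y = hop f y + hop g y := by
  simp only [hop, Pi.add_apply, ← Finset.sum_add_distrib]
  exact Finset.sum_congr rfl fun _ _ => by ring

/-- kernel: the hopping sum is homogeneous. [folklore] -/
private theorem hop_smul (c : ℝ) (f : ZSite d → ℝ) (y : ZSite d) : hop (fun z => c * f z) y = c * hop f y := by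
  simp only [hop, Finset.mul_sum]
  exact Finset.sum_congr rfl fun _ _ => by ring

/-- kernel: the hopping sum of a difference. [folklore] -/
private theorem hop_sub (f g : ZSite d → ℝ) (y : ZSite d) : hop (f - g) y = hop f y - hop g y := by
  simp only [hop, Pi.sub_apply, ← Finset.sum_sub_distrib]
  exact Finset.sum_congr rfl fun _ _ => by ring

/-- kernel: |Hf(y)| ≤ 2d·M whenever |f| ≤ M. [folklore] -/
private theorem abs_hop_le {f : ZSite d → ℝ} {M : ℝ} (hf : ∀ z, |f z| ≤ M) (y : ZSite d) : |hop f y| ≤ 2 * d * M := by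
  unfold hop
  calc |∑ μ : Fin d, (f (y + unitVec μ) + f (y - unitVec μ))|
      ≤ ∑ μ : Fin d, |f (y + unitVec μ) + f (y - unitVec μ)| := Finset.abs_sum_le_sum_abs _ _
    _ ≤ ∑ _μ : Fin d, (M + M) := Finset.sum_le_sum fun μ _ =>
        (abs_add_le _ _).trans (add_le_add (hf _) (hf _))
    _ = 2 * d * M := by
        rw [Finset.sum_const, Finset.card_univ, Fintype.card_fin, nsmul_eq_mul]; ring

end Operators

/-! ## 2. The Brillouin box -/

section Box

/-- kernel: the Brillouin box |p_μ| ≤ π/ξ is the order interval [−π/ξ, π/ξ]^d of ℝ^d. [folklore] -/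
private theorem bzBox_eq_Icc (d : ℕ) (ξ : ℝ) :
    bzBox d ξ = Set.Icc (fun _ : Fin d => -(Real.pi / ξ)) (fun _ => Real.pi / ξ) := by
  rw [← Set.pi_univ_Icc]
  ext p
  simp only [bzBox, Set.mem_setOf_eq, Set.mem_univ_pi, Set.mem_Icc, abs_le]

/-- kernel: the Brillouin box as a product of intervals. [folklore] -/
private theorem bzBox_eq_pi (d : ℕ) (ξ : ℝ) :
    bzBox d ξ = Set.univ.pi fun _ : Fin d => Set.Icc (-(Real.pi / ξ)) (Real.pi / ξ) := by
  rw [Set.pi_univ_Icc]; exact bzBox_eq_Icc d ξ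

/-- kernel: the box is measurable. [folklore] -/
private theorem measurableSet_bzBox' (d : ℕ) (ξ : ℝ) : MeasurableSet (bzBox d ξ) := by
  rw [bzBox_eq_Icc]; exact measurableSet_Icc

/-- kernel: the box is compact. [folklore] -/
private theorem isCompact_bzBox' (d : ℕ) (ξ : ℝ) : IsCompact (bzBox d ξ) := by
  rw [bzBox_eq_Icc]; exact isCompact_Icc

/-- kernel: the volume of the box is (2π/ξ)^d (ξ > 0). [folklore] -/
private theorem volume_real_bzBox {ξ : ℝ} (hξ : 0 < ξ) : volume.real (bzBox d ξ) = (2 * Real.pi / ξ) ^ d := by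
  rw [Measure.real, bzBox_eq_Icc, Real.volume_Icc_pi]
  have h : Real.pi / ξ - -(Real.pi / ξ) = 2 * Real.pi / ξ := by ring
  simp only [h, Finset.prod_const, Finset.card_univ, Fintype.card_fin]
  rw [ENNReal.toReal_pow, ENNReal.toReal_ofReal (by positivity)]

/-- kernel: the box has finite volume. [folklore] -/
private theorem volume_bzBox_lt_top (d : ℕ) (ξ : ℝ) : volume (bzBox d ξ) < ⊤ :=
  (isCompact_bzBox' d ξ).measure_lt_top

/-- kernel: Δ^ξ(p) is continuous. [folklore] -/
private theorem continuous_lapSymbol' (d : ℕ) (ξ : ℝ) : Continuous (lapSymbol d ξ) := by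
  unfold lapSymbol; fun_prop

/-- kernel: Δ^ξ(p) + 1 > 0. [folklore] -/
private theorem lapSymbol_add_one_pos (d : ℕ) (ξ : ℝ) (p : Fin d → ℝ) : 0 < lapSymbol d ξ p + 1 :=
  add_pos_of_nonneg_of_pos (lapSymbol_nonneg d ξ p) one_pos

/-- The integrand of C^ξ(y): cos(ξp·y)/(Δ^ξ(p) + 1) (`phase ξ y p` = ξ Σ_μ p_μy_μ). [cite: Balaban1983Higgs3, (3.16) p.437] -/
def phase (ξ : ℝ) (y : ZSite d) (p : Fin d → ℝ) : ℝ := ξ * ∑ μ : Fin d, p μ * (y μ : ℝ)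

/-- The integrand of C^ξ(y). [cite: Balaban1983Higgs3, (3.16) p.437] -/
def cxiIntegrand (ξ : ℝ) (y : ZSite d) (p : Fin d → ℝ) : ℝ := Real.cos (phase ξ y p) / (lapSymbol d ξ p + 1)

/-- kernel: C^ξ(y) = (2π)^{−d}∫_{|p|≤π/ξ} cxiIntegrand. [cite: Balaban1983Higgs3, (3.16) p.437] -/
theorem Cxi_eq_integral (ξ : ℝ) (y : ZSite d) :
    Cxi d ξ y = (2 * Real.pi)⁻¹ ^ d * ∫ p in bzBox d ξ, cxiIntegrand ξ y p := rfl

/-- kernel: the phase is continuous in p. [folklore] -/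
private theorem continuous_phase (ξ : ℝ) (y : ZSite d) : Continuous (phase ξ y) := by
  unfold phase; fun_prop

/-- kernel: the integrand is continuous in p. [folklore] -/
private theorem continuous_cxiIntegrand (ξ : ℝ) (y : ZSite d) : Continuous (cxiIntegrand (d := d) ξ y) := by
  unfold cxiIntegrand
  exact (Real.continuous_cos.comp (continuous_phase ξ y)).div ((continuous_lapSymbol' d ξ).add continuous_const)
    fun p => (lapSymbol_add_one_pos d ξ p).ne'

/-- kernel: the integrand is integrable on the box. [folklore] -/
private theorem integrableOn_cxiIntegrand (ξ : ℝ) (y : ZSite d) : IntegrableOn (cxiIntegrand ξ y) (bzBox d ξ) volume :=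
  (continuous_cxiIntegrand ξ y).continuousOn.integrableOn_compact (isCompact_bzBox' d ξ)

/-- kernel: |integrand| ≤ 1. [folklore] -/
private theorem abs_cxiIntegrand_le (ξ : ℝ) (y : ZSite d) (p : Fin d → ℝ) : |cxiIntegrand ξ y p| ≤ 1 := by
  unfold cxiIntegrand
  rw [abs_div, abs_of_pos (lapSymbol_add_one_pos d ξ p), div_le_one (lapSymbol_add_one_pos d ξ p)]
  exact (Real.abs_cos_le_one _).trans (by linarith [lapSymbol_nonneg d ξ p])

end Box

/-! ## 3. Orthogonality on the Brillouin box -/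

section Orthogonality

/-- kernel: ∫_{[−π/ξ, π/ξ]} e^{iξtn} dt = (2π/ξ)·[n = 0] for n ∈ ℤ, ξ > 0 (for n ≠ 0 the endpoints give e^{iπn} − e^{−iπn} = 0). [folklore] -/
private theorem integral_Icc_cexp {ξ : ℝ} (hξ : 0 < ξ) (n : ℤ) :
    ∫ t in Set.Icc (-(Real.pi / ξ)) (Real.pi / ξ), Complex.exp (↑(ξ * t * n) * Complex.I) =
      if n = 0 then ((2 * Real.pi / ξ : ℝ) : ℂ) else 0 := by
  have hπξ : 0 < Real.pi / ξ := div_pos Real.pi_pos hξ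
  have ha : -(Real.pi / ξ) ≤ Real.pi / ξ := by linarith
  split_ifs with hn
  · subst hn
    simp only [Int.cast_zero, mul_zero, Complex.ofReal_zero, zero_mul, Complex.exp_zero]
    rw [setIntegral_const, Measure.real, Real.volume_Icc, ENNReal.toReal_ofReal (by linarith), Complex.real_smul,
      mul_one]
    push_cast
    ring
  · rw [integral_Icc_eq_integral_Ioc, ← intervalIntegral.integral_of_le ha]
    have hc : ((ξ : ℂ) * (n : ℂ)) * Complex.I ≠ 0 := by
      refine mul_ne_zero (mul_ne_zero ?_ ?_) Complex.I_ne_zero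
      · exact_mod_cast hξ.ne'
      · exact_mod_cast hn
    have hf : (fun t : ℝ => Complex.exp (↑(ξ * t * n) * Complex.I)) =
        fun t : ℝ => Complex.exp ((ξ : ℂ) * (n : ℂ) * Complex.I * (t : ℂ)) := by
      funext t; congr 1; push_cast; ring
    rw [hf, integral_exp_mul_complex hc]
    have hξ' : (ξ : ℂ) ≠ 0 := by exact_mod_cast hξ.ne'
    have e1 : (ξ : ℂ) * (n : ℂ) * Complex.I * ((Real.pi / ξ : ℝ) : ℂ) = (n : ℂ) * ((Real.pi : ℂ) * Complex.I) := by
      push_cast; field_simp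
    have e2 : (ξ : ℂ) * (n : ℂ) * Complex.I * ((-(Real.pi / ξ) : ℝ) : ℂ) = ((-n : ℤ) : ℂ) * ((Real.pi : ℂ) * Complex.I) := by
      push_cast; field_simp
    rw [e1, e2, Complex.exp_int_mul, Complex.exp_int_mul, Complex.exp_pi_mul_I, zpow_neg, ← inv_zpow, inv_neg_one,
      sub_self, zero_div]

/-- **Orthogonality on the Brillouin box**: ∫_{|p|≤π/ξ} cos(ξp·y) dp = (2π/ξ)^d·[y = 0] for y ∈ ℤ^d, ξ > 0 — the momentum-space
form of the lattice δ-function δ^ξ of p. 437 (product of the one-dimensional integrals). [cite: Balaban1983Higgs3, (3.16) p.437] -/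
theorem integral_bzBox_cos_phase {ξ : ℝ} (hξ : 0 < ξ) (y : ZSite d) :
    ∫ p in bzBox d ξ, Real.cos (phase ξ y p) = if y = 0 then (2 * Real.pi / ξ) ^ d else 0 := by
  set F : (Fin d → ℝ) → ℂ := fun p => ∏ μ : Fin d, Complex.exp (↑(ξ * p μ * y μ) * Complex.I) with hF
  have hFre : ∀ p, Real.cos (phase ξ y p) = (F p).re := by
    intro p
    rw [hF]
    dsimp only
    rw [← Complex.exp_sum, ← Complex.exp_ofReal_mul_I_re]
    congr 2
    unfold phase
    push_cast
    rw [Finset.mul_sum, Finset.sum_mul]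
    exact Finset.sum_congr rfl fun μ _ => by ring
  have hFint : Integrable F (volume.restrict (bzBox d ξ)) := by
    refine ContinuousOn.integrableOn_compact (isCompact_bzBox' d ξ) (Continuous.continuousOn ?_)
    rw [hF]
    fun_prop
  simp_rw [hFre]
  have hre := integral_re hFint
  simp only [RCLike.re_to_complex] at hre
  rw [hre]
  have hprod : ∫ p in bzBox d ξ, F p =
      ∏ μ : Fin d, ∫ t in Set.Icc (-(Real.pi / ξ)) (Real.pi / ξ), Complex.exp (↑(ξ * t * y μ) * Complex.I) := by
    have hv : (volume : Measure (Fin d → ℝ)) = Measure.pi fun _ : Fin d => (volume : Measure ℝ) := volume_pi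
    rw [bzBox_eq_pi, hv, Measure.restrict_pi_pi (fun _ : Fin d => (volume : Measure ℝ))
      (fun _ : Fin d => Set.Icc (-(Real.pi / ξ)) (Real.pi / ξ)), hF]
    exact integral_fintype_prod_eq_prod (𝕜 := ℂ)
      (μ := fun _ : Fin d => (volume : Measure ℝ).restrict (Set.Icc (-(Real.pi / ξ)) (Real.pi / ξ)))
      (fun μ (t : ℝ) => Complex.exp (↑(ξ * t * y μ) * Complex.I))
  rw [hprod]
  simp_rw [integral_Icc_cexp hξ]
  by_cases hy : y = 0
  · subst hy
    simp only [Pi.zero_apply, if_true, Finset.prod_const, Finset.card_univ, Fintype.card_fin]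
    rw [← Complex.ofReal_pow, Complex.ofReal_re]
  · obtain ⟨μ, hμ⟩ : ∃ μ, y μ ≠ 0 := by
      by_contra h
      push Not at h
      exact hy (funext h)
    rw [Finset.prod_eq_zero (Finset.mem_univ μ) (if_neg hμ), if_neg hy, Complex.zero_re]

end Orthogonality

/-! ## 4. The lattice equation (−Δ^ξ + 1)C^ξ = δ^ξ -/

section LatticeEquation

/-- kernel: shifting the site by +e_μ shifts the phase by ξp_μ. [folklore] -/
private theorem phase_add_unitVec (ξ : ℝ) (y : ZSite d) (μ : Fin d) (p : Fin d → ℝ) :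
    phase ξ (y + unitVec μ) p = phase ξ y p + ξ * p μ := by
  unfold phase unitVec
  rw [← mul_add]
  congr 1
  simp only [Pi.add_apply, Pi.single_apply, Int.cast_add, Int.cast_ite, Int.cast_one, Int.cast_zero, mul_add,
    Finset.sum_add_distrib, mul_ite, mul_one, mul_zero, Finset.sum_ite_eq', Finset.mem_univ, if_true]

/-- kernel: shifting the site by −e_μ shifts the phase by −ξp_μ. [folklore] -/
private theorem phase_sub_unitVec (ξ : ℝ) (y : ZSite d) (μ : Fin d) (p : Fin d → ℝ) :
    phase ξ (y - unitVec μ) p = phase ξ y p - ξ * p μ := by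
  have h := phase_add_unitVec ξ (y - unitVec μ) μ p
  rw [sub_add_cancel] at h
  linarith

/-- kernel, the pointwise identity behind the lattice equation: for f_z(p) = cos(ξp·z)/(Δ^ξ(p) + 1),
Σ_μ ξ^{−2}(2f_y − f_{y+e_μ} − f_{y−e_μ}) + f_y = cos(ξp·y) (cos(θ ± ξp_μ) expanded; Σ_μ ξ^{−2}(2 − 2cos ξp_μ) = Δ^ξ(p)).
[cite: Balaban1983Higgs3, (3.16) p.437] -/
theorem negLap_cxiIntegrand (ξ : ℝ) (y : ZSite d) (p : Fin d → ℝ) :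
    ∑ μ : Fin d, ξ⁻¹ ^ 2 * (2 * cxiIntegrand ξ y p - cxiIntegrand ξ (y + unitVec μ) p - cxiIntegrand ξ (y - unitVec μ) p)
      + cxiIntegrand ξ y p = Real.cos (phase ξ y p) := by
  have hD := lapSymbol_add_one_pos d ξ p
  unfold cxiIntegrand
  simp_rw [phase_add_unitVec, phase_sub_unitVec, Real.cos_add, Real.cos_sub]
  have h : ∀ μ : Fin d, ξ⁻¹ ^ 2 * (2 * (Real.cos (phase ξ y p) / (lapSymbol d ξ p + 1)) -
      (Real.cos (phase ξ y p) * Real.cos (ξ * p μ) - Real.sin (phase ξ y p) * Real.sin (ξ * p μ)) /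
        (lapSymbol d ξ p + 1) -
      (Real.cos (phase ξ y p) * Real.cos (ξ * p μ) + Real.sin (phase ξ y p) * Real.sin (ξ * p μ)) /
        (lapSymbol d ξ p + 1)) =
      ξ⁻¹ ^ 2 * (2 - 2 * Real.cos (ξ * p μ)) * (Real.cos (phase ξ y p) / (lapSymbol d ξ p + 1)) := by
    intro μ
    field_simp
    ring
  simp_rw [h]
  rw [← Finset.sum_mul, show ∑ μ : Fin d, ξ⁻¹ ^ 2 * (2 - 2 * Real.cos (ξ * p μ)) = lapSymbol d ξ p from rfl]
  field_simp

/-- **The lattice equation**, p. 437 [PDF 27], verbatim: *"C^ξ = (−Δ^ξ + 1)^{−1} … −Δ^ξC^ξ = δ^ξ − C^ξ"* — PROVED for the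
momentum-integral C^ξ (`Cxi`, ξ > 0): Σ_μ ξ^{−2}(2C^ξ(y) − C^ξ(y + e_μ) − C^ξ(y − e_μ)) + C^ξ(y) = ξ^{−d}·[y = 0] on ℤ^d, where
ξ^{−d}1_{y=0} = δ^ξ is the δ-function of the volume element Σ_yξ^d (linearity of the integral, the pointwise identity
`negLap_cxiIntegrand`, and orthogonality `integral_bzBox_cos_phase`). [cite: Balaban1983Higgs3, (3.16) p.437] -/
theorem negLapZ_Cxi_add {ξ : ℝ} (hξ : 0 < ξ) (y : ZSite d) :
    negLapZ ξ (Cxi d ξ) y + Cxi d ξ y = if y = 0 then ξ⁻¹ ^ d else 0 := by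
  set f : ZSite d → (Fin d → ℝ) → ℝ := fun z p => cxiIntegrand ξ z p with hf
  set I : ZSite d → ℝ := fun z => ∫ p in bzBox d ξ, f z p with hI
  have hC : ∀ z, Cxi d ξ z = (2 * Real.pi)⁻¹ ^ d * I z := fun z => rfl
  have hint : ∀ z, Integrable (f z) (volume.restrict (bzBox d ξ)) := fun z => integrableOn_cxiIntegrand ξ z
  -- the left side in terms of the integrals I z
  have hL : negLapZ ξ (Cxi d ξ) y + Cxi d ξ y =
      (2 * Real.pi)⁻¹ ^ d * (∑ μ : Fin d, ξ⁻¹ ^ 2 * (2 * I y - I (y + unitVec μ) - I (y - unitVec μ)) + I y) := by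
    simp only [negLapZ, hC]
    rw [mul_add, Finset.mul_sum]
    congr 1
    exact Finset.sum_congr rfl fun μ _ => by ring
  -- linearity of the integral
  set g : Fin d → (Fin d → ℝ) → ℝ := fun μ p => ξ⁻¹ ^ 2 * (2 * f y p - f (y + unitVec μ) p - f (y - unitVec μ) p) with hg
  have hgint : ∀ μ, Integrable (g μ) (volume.restrict (bzBox d ξ)) := fun μ =>
    ((((hint y).const_mul 2).sub (hint _)).sub (hint _)).const_mul _
  have hgI : ∀ μ, ∫ p in bzBox d ξ, g μ p = ξ⁻¹ ^ 2 * (2 * I y - I (y + unitVec μ) - I (y - unitVec μ)) := by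
    intro μ
    have i1 : Integrable (fun p => 2 * f y p) (volume.restrict (bzBox d ξ)) := (hint y).const_mul 2
    have i2 : Integrable (fun p => 2 * f y p - f (y + unitVec μ) p) (volume.restrict (bzBox d ξ)) :=
      i1.sub (hint _)
    have e1 : ∫ p in bzBox d ξ, (2 * f y p - f (y + unitVec μ) p - f (y - unitVec μ) p) =
        (∫ p in bzBox d ξ, (2 * f y p - f (y + unitVec μ) p)) - ∫ p in bzBox d ξ, f (y - unitVec μ) p :=
      integral_sub i2 (hint _)
    have e2 : ∫ p in bzBox d ξ, (2 * f y p - f (y + unitVec μ) p) =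
        (∫ p in bzBox d ξ, 2 * f y p) - ∫ p in bzBox d ξ, f (y + unitVec μ) p :=
      integral_sub i1 (hint _)
    have e3 : ∫ p in bzBox d ξ, 2 * f y p = 2 * ∫ p in bzBox d ξ, f y p := integral_const_mul _ _
    simp only [hg, hI]
    rw [integral_const_mul, e1, e2, e3]
  have hR : ∫ p in bzBox d ξ, Real.cos (phase ξ y p) =
      ∑ μ : Fin d, ξ⁻¹ ^ 2 * (2 * I y - I (y + unitVec μ) - I (y - unitVec μ)) + I y := by
    have h1 : ∫ p in bzBox d ξ, Real.cos (phase ξ y p) = ∫ p in bzBox d ξ, ((∑ μ : Fin d, g μ p) + f y p) :=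
      integral_congr_ae (ae_of_all _ fun p => (negLap_cxiIntegrand ξ y p).symm)
    rw [h1, integral_add (integrable_finsetSum _ fun μ _ => hgint μ) (hint y),
      integral_finsetSum _ fun μ _ => hgint μ]
    simp_rw [hgI]
    rfl
  rw [hL, ← hR, integral_bzBox_cos_phase hξ y]
  split_ifs with hy
  · rw [← mul_pow]
    congr 1
    field_simp
  · rw [mul_zero]

/-- p. 437, the printed form *"Σ_{ν=1}^d ∂^ξ_νC^ξ∂^{ξ*}_ν = −Δ^ξC^ξ = δ^ξ − C^ξ"* — PROVED on ℤ^d for the momentum-integral C^ξ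
(ξ > 0): Σ_ν (∂^ξ_ν∂^{ξ*}_νC^ξ)(y) = ξ^{−d}[y = 0] − C^ξ(y). [cite: Balaban1983Higgs3, (3.16) p.437] -/
theorem sum_pdiffZ_Cxi_pdiffAdjZ {ξ : ℝ} (hξ : 0 < ξ) (y : ZSite d) :
    ∑ ν : Fin d, pdiffZ ξ⁻¹ ν (pdiffAdjZ ξ⁻¹ ν (Cxi d ξ)) y = (if y = 0 then ξ⁻¹ ^ d else 0) - Cxi d ξ y := by
  rw [sum_pdiffZ_pdiffAdjZ, ← negLapZ_Cxi_add hξ y, add_sub_cancel_right]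

/-- kernel: the a-priori bound |C^ξ(y)| ≤ ξ^{−d} (|integrand| ≤ 1 on a box of volume (2π/ξ)^d). [cite: Balaban1983Higgs3, (3.16) p.437] -/
theorem abs_Cxi_le {ξ : ℝ} (hξ : 0 < ξ) (y : ZSite d) : |Cxi d ξ y| ≤ ξ⁻¹ ^ d := by
  have h := norm_setIntegral_le_of_norm_le_const (volume_bzBox_lt_top d ξ)
    (fun p _ => (Real.norm_eq_abs _).le.trans (abs_cxiIntegrand_le ξ y p))
  rw [volume_real_bzBox hξ, one_mul, Real.norm_eq_abs] at h
  rw [Cxi_eq_integral, abs_mul, abs_of_pos (by positivity)]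
  calc (2 * Real.pi)⁻¹ ^ d * |∫ p in bzBox d ξ, cxiIntegrand ξ y p|
      ≤ (2 * Real.pi)⁻¹ ^ d * (2 * Real.pi / ξ) ^ d := by gcongr
    _ = ξ⁻¹ ^ d := by rw [← mul_pow]; congr 1; field_simp

end LatticeEquation

/-! ## 5. Nearest-neighbour walk counts -/

section Walks

/-- W_k(y) = the number of nearest-neighbour walks of length k from 0 to y in ℤ^d: W₀ = 1_{0}, W_{k+1} = HW_k (the
position-space random-walk expansion of (−Δ^ξ + 1)^{−1}). [cite: Balaban1983Higgs3, (3.16) p.437] -/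
def walkCount : ℕ → ZSite d → ℝ
  | 0 => fun y => if y = 0 then 1 else 0
  | k + 1 => hop (walkCount k)

/-- kernel: W₀ = 1_{0}. [folklore] -/
@[simp] private theorem walkCount_zero (y : ZSite d) : walkCount 0 y = if y = 0 then 1 else 0 := rfl

/-- kernel: W_{k+1} = HW_k. [folklore] -/
@[simp] private theorem walkCount_succ (k : ℕ) : walkCount (d := d) (k + 1) = hop (walkCount k) := rfl

/-- kernel: W_k ≥ 0. [folklore] -/
private theorem walkCount_nonneg : ∀ (k : ℕ) (y : ZSite d), 0 ≤ walkCount k y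
  | 0, y => by
      rw [walkCount_zero]
      split_ifs <;> norm_num
  | k + 1, y => by
      rw [walkCount_succ]
      exact Finset.sum_nonneg fun μ _ => add_nonneg (walkCount_nonneg k _) (walkCount_nonneg k _)

/-- kernel: W_k ≤ (2d)^k. [folklore] -/
private theorem walkCount_le : ∀ (k : ℕ) (y : ZSite d), walkCount k y ≤ (2 * d) ^ k
  | 0, y => by
      rw [walkCount_zero, pow_zero]
      split_ifs <;> norm_num
  | k + 1, y => by
      rw [walkCount_succ, pow_succ']
      have h : ∀ z : ZSite d, |walkCount k z| ≤ (2 * d) ^ k := fun z => by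
        rw [abs_of_nonneg (walkCount_nonneg k z)]
        exact walkCount_le k z
      calc hop (walkCount k) y ≤ |hop (walkCount k) y| := le_abs_self _
        _ ≤ 2 * d * (2 * d) ^ k := abs_hop_le h y

/-- |y|₁ = Σ_μ |y_μ|, the ℓ¹ size of a site of ℤ^d in lattice units (the number of lattice steps from 0; the distances
|y − y′| of p. 437 are ξ|y − y′| in these units, up to the choice of norm). [cite: Balaban1983Higgs3, (3.16) p.437] -/
def l1 (y : ZSite d) : ℕ := ∑ μ : Fin d, (y μ).natAbs

/-- kernel: |0|₁ = 0. [folklore] -/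
@[simp] private theorem l1_zero : l1 (0 : ZSite d) = 0 := by
  simp [l1]

/-- kernel: |y|₁ = 0 only for y = 0. [folklore] -/
private theorem eq_zero_of_l1_eq_zero {y : ZSite d} (h : l1 y = 0) : y = 0 := by
  funext μ
  have hμ := (Finset.sum_eq_zero_iff.mp h) μ (Finset.mem_univ μ)
  exact Int.natAbs_eq_zero.mp hμ

/-- kernel: triangle inequality |a|₁ ≤ |a + v|₁ + |v|₁. [folklore] -/
private theorem l1_le_l1_add_add (a v : ZSite d) : l1 a ≤ l1 (a + v) + l1 v := by
  unfold l1
  rw [← Finset.sum_add_distrib]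
  refine Finset.sum_le_sum fun μ _ => ?_
  have h : a μ = (a + v) μ - v μ := by simp
  calc (a μ).natAbs = ((a + v) μ - v μ).natAbs := by rw [← h]
    _ ≤ ((a + v) μ).natAbs + (v μ).natAbs := Int.natAbs_sub_le _ _

/-- kernel: |c·e_μ|₁ = |c|. [folklore] -/
private theorem l1_single (μ : Fin d) (c : ℤ) : l1 (Pi.single μ c : ZSite d) = c.natAbs := by
  simp only [l1, Pi.single_apply, apply_ite Int.natAbs, Int.natAbs_zero, Finset.sum_ite_eq', Finset.mem_univ,
    if_true]

/-- kernel: |e_μ|₁ = 1. [folklore] -/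
private theorem l1_unitVec (μ : Fin d) : l1 (unitVec (d := d) μ) = 1 := by
  unfold unitVec
  rw [l1_single]
  rfl

/-- kernel: |−e_μ|₁ = 1. [folklore] -/
private theorem l1_neg_unitVec (μ : Fin d) : l1 (-unitVec (d := d) μ) = 1 := by
  unfold unitVec
  rw [← Pi.single_neg, l1_single]
  rfl

/-- kernel: |y|₁ ≤ |y + e_μ|₁ + 1. [folklore] -/
private theorem l1_le_add_unitVec (y : ZSite d) (μ : Fin d) : l1 y ≤ l1 (y + unitVec μ) + 1 := by
  have h := l1_le_l1_add_add y (unitVec μ)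
  rwa [l1_unitVec] at h

/-- kernel: |y|₁ ≤ |y − e_μ|₁ + 1. [folklore] -/
private theorem l1_le_sub_unitVec (y : ZSite d) (μ : Fin d) : l1 y ≤ l1 (y - unitVec μ) + 1 := by
  have h := l1_le_l1_add_add y (-unitVec μ)
  rwa [l1_neg_unitVec, ← sub_eq_add_neg] at h

/-- kernel: W_k is supported in |y|₁ ≤ k (a walk of length k reaches at most ℓ¹-distance k). [folklore] -/
private theorem walkCount_eq_zero_of_lt : ∀ (k : ℕ) (y : ZSite d), k < l1 y → walkCount k y = 0
  | 0, y, h => by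
      rw [walkCount_zero, if_neg]
      rintro rfl
      simp at h
  | k + 1, y, h => by
      rw [walkCount_succ]
      refine Finset.sum_eq_zero fun μ _ => ?_
      rw [walkCount_eq_zero_of_lt k _ (by have := l1_le_add_unitVec y μ; omega),
        walkCount_eq_zero_of_lt k _ (by have := l1_le_sub_unitVec y μ; omega), add_zero]

/-- kernel: the ℓ¹-balls of ℤ^d are finite. [folklore] -/
private theorem finite_l1_le (k : ℕ) : {y : ZSite d | l1 y ≤ k}.Finite := by
  refine (Set.Finite.pi (t := fun _ : Fin d => Set.Icc (-(k : ℤ)) k) fun _ => Set.finite_Icc _ _).subset ?_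
  intro y hy
  simp only [Set.mem_setOf_eq] at hy
  simp only [Set.mem_pi, Set.mem_univ, true_implies, Set.mem_Icc]
  intro μ
  have h1 : (y μ).natAbs ≤ k :=
    le_trans (Finset.single_le_sum (fun ν _ => Nat.zero_le ((y ν).natAbs)) (Finset.mem_univ μ)) hy
  omega

/-- kernel: W_k has finite support. [folklore] -/
private theorem finite_support_walkCount (k : ℕ) : (Function.support (walkCount (d := d) k)).Finite :=
  (finite_l1_le k).subset fun y hy => by
    by_contra h
    simp only [Set.mem_setOf_eq, not_le] at h
    exact hy (walkCount_eq_zero_of_lt k y h)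

/-- kernel: any weight against W_k is summable (finite support). [folklore] -/
private theorem summable_mul_walkCount (w : ZSite d → ℝ) (k : ℕ) : Summable fun y => w y * walkCount k y :=
  summable_of_hasFiniteSupport ((finite_support_walkCount k).subset (Function.support_mul_subset_right _ _))

/-- kernel: W_k is summable. [folklore] -/
private theorem summable_walkCount (k : ℕ) : Summable (walkCount (d := d) k) := by
  simpa only [one_mul] using summable_mul_walkCount (fun _ => (1 : ℝ)) k

/-- kernel: the total hopping sum is 2d times the total sum, Σ_y (Hf)(y) = 2d·Σ_y f(y), for summable f. [folklore] -/
private theorem tsum_hop {f : ZSite d → ℝ} (hf : Summable f) : ∑' y, hop f y = 2 * d * ∑' y, f y := by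
  have hs : ∀ u : ZSite d, Summable fun y => f (y + u) := fun u =>
    (Equiv.summable_iff (Equiv.addRight u)).mpr hf
  have ht : ∀ u : ZSite d, ∑' y, f (y + u) = ∑' y, f y := fun u => Equiv.tsum_eq (Equiv.addRight u) f
  have h : HasSum (fun y => hop f y) (∑ _μ : Fin d, ((∑' y, f y) + ∑' y, f y)) := by
    refine hasSum_sum fun μ _ => ?_
    have h1 := (hs (unitVec μ)).hasSum
    have h2 := (hs (-unitVec μ)).hasSum
    rw [ht] at h1 h2
    simpa only [sub_eq_add_neg] using h1.add h2
  rw [h.tsum_eq, Finset.sum_const, Finset.card_univ, Fintype.card_fin, nsmul_eq_mul]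
  ring

/-- kernel: Σ_y W_k(y) = (2d)^k. [folklore] -/
private theorem tsum_walkCount : ∀ k : ℕ, ∑' y : ZSite d, walkCount k y = (2 * d) ^ k
  | 0 => by simp [walkCount_zero, tsum_ite_eq]
  | k + 1 => by rw [walkCount_succ, tsum_hop (summable_walkCount k), tsum_walkCount k, pow_succ']

/-- kernel: polynomially weighted sums of W_k: Σ_y (1 + |y|₁)^m W_k(y) ≤ (1 + k)^m (2d)^k. [folklore] -/
private theorem tsum_weight_walkCount_le (m k : ℕ) :
    ∑' y : ZSite d, (1 + (l1 y : ℝ)) ^ m * walkCount k y ≤ (1 + k : ℝ) ^ m * (2 * d) ^ k := by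
  have hle : ∀ y : ZSite d, (1 + (l1 y : ℝ)) ^ m * walkCount k y ≤ (1 + k : ℝ) ^ m * walkCount k y := by
    intro y
    rcases lt_or_ge k (l1 y) with h | h
    · rw [walkCount_eq_zero_of_lt k y h, mul_zero, mul_zero]
    · exact mul_le_mul_of_nonneg_right (pow_le_pow_left₀ (by positivity) (by exact_mod_cast Nat.add_le_add_left h 1) m)
        (walkCount_nonneg k y)
  calc ∑' y : ZSite d, (1 + (l1 y : ℝ)) ^ m * walkCount k y
      ≤ ∑' y : ZSite d, (1 + k : ℝ) ^ m * walkCount k y :=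
        (summable_mul_walkCount _ k).tsum_le_tsum hle (summable_mul_walkCount _ k)
    _ = (1 + k : ℝ) ^ m * (2 * d) ^ k := by rw [tsum_mul_left, tsum_walkCount]

end Walks

/-! ## 6. The Neumann series -/

section Neumann

/-- θ = (2d + ξ²)^{−1}: the hopping weight of the fixed-point form f = θ·Hf + θξ²·ξ^{−d}1_{0} of the lattice equation
(−Δ^ξ + 1)f = δ^ξ. [cite: Balaban1983Higgs3, (3.16) p.437] -/
def hopWeight (d : ℕ) (ξ : ℝ) : ℝ := (2 * d + ξ ^ 2)⁻¹

variable {ξ : ℝ}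

/-- kernel: θ > 0. [folklore] -/
private theorem hopWeight_pos (hξ : 0 < ξ) : 0 < hopWeight d ξ := by
  unfold hopWeight; positivity

/-- kernel: 2dθ ≥ 0. [folklore] -/
private theorem rho_nonneg (hξ : 0 < ξ) : 0 ≤ 2 * d * hopWeight d ξ :=
  mul_nonneg (by positivity) (hopWeight_pos hξ).le

/-- kernel: 1 − 2dθ = θξ². [folklore] -/
private theorem one_sub_rho (hξ : 0 < ξ) : 1 - 2 * d * hopWeight d ξ = hopWeight d ξ * ξ ^ 2 := by
  unfold hopWeight
  have hne : (2 * d + ξ ^ 2 : ℝ) ≠ 0 := by positivity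
  field_simp
  ring

/-- kernel: 2dθ < 1. [folklore] -/
private theorem rho_lt_one (hξ : 0 < ξ) : 2 * d * hopWeight d ξ < 1 := by
  have h := one_sub_rho (d := d) hξ
  nlinarith [hopWeight_pos (d := d) hξ, pow_pos hξ 2]

/-- kernel: the lattice equation in fixed-point form — if (−Δ^ξ + 1)f = ξ^{−d}1_{0} then f = θ·Hf + θξ²·ξ^{−d}1_{0}.
[cite: Balaban1983Higgs3, (3.16) p.437] -/
theorem fixedPoint_of_latticeEq (hξ : 0 < ξ) {f : ZSite d → ℝ}
    (h : ∀ y, negLapZ ξ f y + f y = if y = 0 then ξ⁻¹ ^ d else 0) (y : ZSite d) :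
    f y = hopWeight d ξ * hop f y + hopWeight d ξ * ξ ^ 2 * (if y = 0 then ξ⁻¹ ^ d else 0) := by
  have hy := h y
  rw [negLapZ_eq_hop] at hy
  have h2 : ξ ^ 2 * ξ⁻¹ ^ 2 = 1 := by rw [← mul_pow, mul_inv_cancel₀ hξ.ne', one_pow]
  have h3 : (2 * d + ξ ^ 2) * f y = hop f y + ξ ^ 2 * (if y = 0 then ξ⁻¹ ^ d else 0) := by
    linear_combination ξ ^ 2 * hy - (2 * d * f y - hop f y) * h2
  unfold hopWeight
  have hne : (2 * d + ξ ^ 2 : ℝ) ≠ 0 := by positivity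
  calc f y = (2 * d + ξ ^ 2 : ℝ)⁻¹ * ((2 * d + ξ ^ 2) * f y) := by
        rw [← mul_assoc, inv_mul_cancel₀ hne, one_mul]
    _ = _ := by rw [h3]; ring

/-- The Neumann (random-walk) series K(y) = θξ²·ξ^{−d}·Σ_k θ^kW_k(y) — the position-space expansion of (−Δ^ξ + 1)^{−1}.
[cite: Balaban1983Higgs3, (3.16) p.437] -/
def neumannK (d : ℕ) (ξ : ℝ) (y : ZSite d) : ℝ :=
  hopWeight d ξ * ξ ^ 2 * ξ⁻¹ ^ d * ∑' k : ℕ, hopWeight d ξ ^ k * walkCount k y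

/-- kernel: the terms θ^kW_k(y) are dominated by the geometric sequence (2dθ)^k. [folklore] -/
private theorem neumann_term_le (hξ : 0 < ξ) (k : ℕ) (y : ZSite d) :
    hopWeight d ξ ^ k * walkCount k y ≤ (2 * d * hopWeight d ξ) ^ k := by
  rw [mul_pow, mul_comm]
  exact mul_le_mul_of_nonneg_right (walkCount_le k y) (pow_nonneg (hopWeight_pos hξ).le k)

/-- kernel: the terms are nonnegative. [folklore] -/
private theorem neumann_term_nonneg (hξ : 0 < ξ) (k : ℕ) (y : ZSite d) : 0 ≤ hopWeight d ξ ^ k * walkCount k y :=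
  mul_nonneg (pow_nonneg (hopWeight_pos hξ).le k) (walkCount_nonneg k y)

/-- kernel: the Neumann series converges at every site. [folklore] -/
private theorem summable_neumann_terms (hξ : 0 < ξ) (y : ZSite d) : Summable fun k : ℕ => hopWeight d ξ ^ k * walkCount k y :=
  Summable.of_nonneg_of_le (neumann_term_nonneg hξ · y) (neumann_term_le hξ · y)
    (summable_geometric_of_lt_one (rho_nonneg hξ) (rho_lt_one hξ))

/-- kernel: K ≥ 0. [folklore] -/
private theorem neumannK_nonneg (hξ : 0 < ξ) (y : ZSite d) : 0 ≤ neumannK d ξ y :=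
  mul_nonneg (mul_nonneg (mul_nonneg (hopWeight_pos hξ).le (sq_nonneg ξ)) (pow_nonneg (inv_pos.2 hξ).le d))
    (tsum_nonneg fun k => neumann_term_nonneg hξ k y)

/-- kernel: K ≤ ξ^{−d} (geometric series: θξ²·Σ_k(2dθ)^k = θξ²/(1 − 2dθ) = 1). [folklore] -/
private theorem neumannK_le (hξ : 0 < ξ) (y : ZSite d) : neumannK d ξ y ≤ ξ⁻¹ ^ d := by
  have hgeom := summable_geometric_of_lt_one (rho_nonneg (d := d) hξ) (rho_lt_one hξ)
  have h1 : ∑' k : ℕ, hopWeight d ξ ^ k * walkCount k y ≤ (1 - 2 * d * hopWeight d ξ)⁻¹ := by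
    rw [← tsum_geometric_of_lt_one (rho_nonneg (d := d) hξ) (rho_lt_one hξ)]
    exact (summable_neumann_terms hξ y).tsum_le_tsum (fun k => neumann_term_le hξ k y) hgeom
  have hc : 0 ≤ hopWeight d ξ * ξ ^ 2 * ξ⁻¹ ^ d :=
    mul_nonneg (mul_nonneg (hopWeight_pos hξ).le (sq_nonneg ξ)) (pow_nonneg (inv_pos.2 hξ).le d)
  calc neumannK d ξ y ≤ hopWeight d ξ * ξ ^ 2 * ξ⁻¹ ^ d * (1 - 2 * d * hopWeight d ξ)⁻¹ :=
        mul_le_mul_of_nonneg_left h1 hc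
    _ = ξ⁻¹ ^ d := by
        rw [one_sub_rho hξ]
        have hθ : hopWeight d ξ * ξ ^ 2 ≠ 0 := mul_ne_zero (hopWeight_pos hξ).ne' (pow_ne_zero 2 hξ.ne')
        calc hopWeight d ξ * ξ ^ 2 * ξ⁻¹ ^ d * (hopWeight d ξ * ξ ^ 2)⁻¹
            = (hopWeight d ξ * ξ ^ 2) * (hopWeight d ξ * ξ ^ 2)⁻¹ * ξ⁻¹ ^ d := by ring
          _ = ξ⁻¹ ^ d := by rw [mul_inv_cancel₀ hθ, one_mul]

/-- kernel: K solves the fixed-point form of the lattice equation, K = θ·HK + θξ²·ξ^{−d}1_{0} (HW_k = W_{k+1} and the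
shift of the series). [cite: Balaban1983Higgs3, (3.16) p.437] -/
theorem neumannK_fixedPoint (hξ : 0 < ξ) (y : ZSite d) :
    neumannK d ξ y = hopWeight d ξ * hop (neumannK d ξ) y + hopWeight d ξ * ξ ^ 2 * (if y = 0 then ξ⁻¹ ^ d else 0) := by
  have hsum : ∀ z, Summable fun k => hopWeight d ξ ^ k * walkCount k z := fun z => summable_neumann_terms hξ z
  -- (i) the hopping sum of the series, term by term: H(Σ_k θ^kW_k) = Σ_k θ^kW_{k+1}
  have hHS : HasSum (fun k => hopWeight d ξ ^ k * walkCount (k + 1) y)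
      (hop (fun z => ∑' k, hopWeight d ξ ^ k * walkCount k z) y) := by
    have h : HasSum (fun k => ∑ μ : Fin d, (hopWeight d ξ ^ k * walkCount k (y + unitVec μ) +
        hopWeight d ξ ^ k * walkCount k (y - unitVec μ)))
        (∑ μ : Fin d, ((∑' k, hopWeight d ξ ^ k * walkCount k (y + unitVec μ)) +
          ∑' k, hopWeight d ξ ^ k * walkCount k (y - unitVec μ))) :=
      hasSum_sum fun μ _ => ((hsum _).hasSum).add ((hsum _).hasSum)
    refine h.congr_fun fun k => ?_
    rw [walkCount_succ]
    unfold hop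
    rw [Finset.mul_sum]
    exact Finset.sum_congr rfl fun μ _ => by ring
  -- (ii) the shift Σ_k θ^kW_k = W₀ + θ·Σ_k θ^kW_{k+1}
  have h1 : Summable fun k => hopWeight d ξ ^ (k + 1) * walkCount (k + 1) y :=
    (summable_nat_add_iff (f := fun k => hopWeight d ξ ^ k * walkCount k y) 1).mpr (hsum y)
  have hshift : ∑' k, hopWeight d ξ ^ k * walkCount k y =
      (if y = 0 then 1 else 0) + hopWeight d ξ * hop (fun z => ∑' k, hopWeight d ξ ^ k * walkCount k z) y := by
    rw [tsum_eq_zero_add' (f := fun k => hopWeight d ξ ^ k * walkCount k y) h1, ← hHS.tsum_eq, ← tsum_mul_left,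
      pow_zero, one_mul, walkCount_zero]
    congr 1
    exact tsum_congr fun k => by rw [pow_succ]; ring
  -- (iii) assemble
  unfold neumannK
  rw [hop_smul, hshift]
  split_ifs <;> ring

/-- **Uniqueness of bounded solutions**: a bounded e with e = θ·He vanishes (sup-contraction with ratio 2dθ < 1).
[cite: Balaban1983Higgs3, (3.16) p.437] -/
theorem eq_zero_of_hop_fixedPoint (hξ : 0 < ξ) {e : ZSite d → ℝ} {M : ℝ} (hM : ∀ y, |e y| ≤ M)
    (he : ∀ y, e y = hopWeight d ξ * hop e y) (y : ZSite d) : e y = 0 := by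
  have hbdd : BddAbove (Set.range fun z => |e z|) := ⟨M, by rintro _ ⟨z, rfl⟩; exact hM z⟩
  have hB : ∀ z, |e z| ≤ ⨆ w, |e w| := fun z => le_ciSup hbdd z
  have hstep : ∀ z, |e z| ≤ 2 * d * hopWeight d ξ * ⨆ w, |e w| := fun z => by
    rw [he z, abs_mul, abs_of_pos (hopWeight_pos hξ)]
    calc hopWeight d ξ * |hop e z| ≤ hopWeight d ξ * (2 * d * ⨆ w, |e w|) :=
          mul_le_mul_of_nonneg_left (abs_hop_le hB z) (hopWeight_pos hξ).le
      _ = 2 * d * hopWeight d ξ * ⨆ w, |e w| := by ring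
  have hBle : (⨆ w, |e w|) ≤ 2 * d * hopWeight d ξ * ⨆ w, |e w| := ciSup_le hstep
  have hB0 : (⨆ w, |e w|) ≤ 0 := by
    by_contra h
    push Not at h
    have := mul_lt_mul_of_pos_right (rho_lt_one (d := d) hξ) h
    linarith
  exact abs_nonpos_iff.mp ((hB y).trans hB0)

end Neumann

/-! ## 7. C^ξ = K and its consequences -/

section Identification

variable {ξ : ℝ}

/-- **C^ξ equals its Neumann series**: the momentum-integral C^ξ and the random-walk series K both solve the fixed-point
form of the lattice equation and are bounded, so they coincide. [cite: Balaban1983Higgs3, (3.16) p.437] -/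
theorem Cxi_eq_neumannK (hξ : 0 < ξ) (y : ZSite d) : Cxi d ξ y = neumannK d ξ y := by
  have h := eq_zero_of_hop_fixedPoint hξ (e := fun z => Cxi d ξ z - neumannK d ξ z) (M := ξ⁻¹ ^ d + ξ⁻¹ ^ d)
    (fun z => (abs_sub _ _).trans (add_le_add (abs_Cxi_le hξ z)
      (by rw [abs_of_nonneg (neumannK_nonneg hξ z)]; exact neumannK_le hξ z)))
    (fun z => by
      have h1 := fixedPoint_of_latticeEq hξ (negLapZ_Cxi_add hξ) z
      have h2 := neumannK_fixedPoint hξ z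
      rw [show (fun w => Cxi d ξ w - neumannK d ξ w) = Cxi d ξ - neumannK d ξ from rfl, hop_sub, mul_sub]
      linarith)
    y
  exact sub_eq_zero.mp h

/-- **C^ξ ≥ 0** (entrywise positivity of (−Δ^ξ + 1)^{−1}). [cite: Balaban1983Higgs3, (3.16) p.437] -/
theorem Cxi_nonneg (hξ : 0 < ξ) (y : ZSite d) : 0 ≤ Cxi d ξ y := by
  rw [Cxi_eq_neumannK hξ]; exact neumannK_nonneg hξ y

/-- kernel: Σ_k (1 + k)^m ρ^k < ∞ for 0 ≤ ρ < 1. [folklore] -/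
private theorem summable_poly_mul_geometric (m : ℕ) {ρ : ℝ} (h0 : 0 ≤ ρ) (h1 : ρ < 1) :
    Summable fun k : ℕ => (1 + k : ℝ) ^ m * ρ ^ k := by
  have hρ : ‖ρ‖ < 1 := by rwa [Real.norm_eq_abs, abs_of_nonneg h0]
  have h : ∀ k : ℕ, (1 + k : ℝ) ^ m * ρ ^ k =
      ∑ j ∈ Finset.range (m + 1), ((m.choose j : ℝ) * ((k : ℝ) ^ j * ρ ^ k)) := by
    intro k
    rw [add_comm, add_pow, Finset.sum_mul]
    exact Finset.sum_congr rfl fun j _ => by ring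
  simp_rw [h]
  exact summable_sum fun j _ => (summable_pow_mul_geometric_of_norm_lt_one j hρ).mul_left _

/-- kernel: the doubly indexed family (k, y) ↦ (1 + |y|₁)^m θ^k W_k(y) is summable (Tonelli: inner sums ≤ (1+k)^m(2dθ)^k).
[folklore] -/
private theorem summable_weight_prod (hξ : 0 < ξ) (m : ℕ) :
    Summable fun q : ℕ × ZSite d => ((1 + (l1 q.2 : ℝ)) ^ m * hopWeight d ξ ^ q.1) * walkCount q.1 q.2 := by
  have hnn : 0 ≤ fun q : ℕ × ZSite d => ((1 + (l1 q.2 : ℝ)) ^ m * hopWeight d ξ ^ q.1) * walkCount q.1 q.2 :=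
    fun q => mul_nonneg (mul_nonneg (by positivity) (pow_nonneg (hopWeight_pos hξ).le _)) (walkCount_nonneg _ _)
  refine (summable_prod_of_nonneg hnn).mpr ⟨fun k => summable_mul_walkCount _ k, ?_⟩
  refine Summable.of_nonneg_of_le (fun k => tsum_nonneg fun y => hnn (k, y)) (fun k => ?_)
    (summable_poly_mul_geometric m (rho_nonneg (d := d) hξ) (rho_lt_one hξ))
  dsimp only
  have h : ∑' y : ZSite d, (1 + (l1 y : ℝ)) ^ m * hopWeight d ξ ^ k * walkCount k y =
      hopWeight d ξ ^ k * ∑' y : ZSite d, (1 + (l1 y : ℝ)) ^ m * walkCount k y := by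
    rw [← tsum_mul_left]
    exact tsum_congr fun y => by ring
  rw [h, mul_pow, show (1 + k : ℝ) ^ m * ((2 * d) ^ k * hopWeight d ξ ^ k) =
    hopWeight d ξ ^ k * ((1 + k : ℝ) ^ m * (2 * d) ^ k) by ring]
  exact mul_le_mul_of_nonneg_left (tsum_weight_walkCount_le m k) (pow_nonneg (hopWeight_pos hξ).le k)

/-- **Summability of C^ξ with polynomial weights**: Σ_y (1 + |y|₁)^m C^ξ(y) < ∞ for every m (ξ > 0) — in particular C^ξ,
|y|C^ξ(y) are summable over ξℤ^d, the convergence bookkeeping used for (3.27). [cite: Balaban1983Higgs3, (3.16) p.437] -/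
theorem summable_weight_Cxi (hξ : 0 < ξ) (m : ℕ) : Summable fun y : ZSite d => (1 + (l1 y : ℝ)) ^ m * Cxi d ξ y := by
  have h := ((summable_weight_prod (d := d) hξ m).prod_symm).prod
  have hc : ∀ y : ZSite d, (1 + (l1 y : ℝ)) ^ m * Cxi d ξ y = hopWeight d ξ * ξ ^ 2 * ξ⁻¹ ^ d *
      ∑' k : ℕ, ((1 + (l1 y : ℝ)) ^ m * hopWeight d ξ ^ k) * walkCount k y := by
    intro y
    rw [Cxi_eq_neumannK hξ, neumannK, mul_left_comm, ← tsum_mul_left]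
    congr 1
    exact tsum_congr fun k => by ring
  simp_rw [hc]
  exact h.mul_left _

/-- kernel: C^ξ is summable. [cite: Balaban1983Higgs3, (3.16) p.437] -/
theorem summable_Cxi (hξ : 0 < ξ) : Summable (Cxi d ξ) := by
  simpa only [pow_zero, one_mul] using summable_weight_Cxi hξ 0

/-- **Unit mass**: Σ_y ξ^d C^ξ(y) = 1, i.e. (−Δ^ξ + 1)^{−1}1 = 1 (θξ²·Σ_k(2dθ)^k = 1). [cite: Balaban1983Higgs3, (3.16) p.437] -/
theorem tsum_Cxi (hξ : 0 < ξ) : ∑' y : ZSite d, ξ ^ d * Cxi d ξ y = 1 := by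
  have hG := summable_weight_prod (d := d) hξ 0
  simp only [pow_zero, one_mul] at hG
  have hswap : ∑' y : ZSite d, ∑' k : ℕ, hopWeight d ξ ^ k * walkCount k y =
      ∑' k : ℕ, ∑' y : ZSite d, hopWeight d ξ ^ k * walkCount k y :=
    Summable.tsum_comm' hG (fun k => summable_mul_walkCount _ k) (fun y => summable_neumann_terms hξ y)
  have hinner : ∀ k : ℕ, ∑' y : ZSite d, hopWeight d ξ ^ k * walkCount k y = (2 * d * hopWeight d ξ) ^ k := by
    intro k
    rw [tsum_mul_left, tsum_walkCount]
    ring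
  simp_rw [Cxi_eq_neumannK hξ, neumannK]
  rw [tsum_mul_left, tsum_mul_left, hswap]
  simp_rw [hinner]
  rw [tsum_geometric_of_lt_one (rho_nonneg hξ) (rho_lt_one hξ), one_sub_rho hξ]
  have h1 : ξ ^ d * ξ⁻¹ ^ d = 1 := by rw [← mul_pow, mul_inv_cancel₀ hξ.ne', one_pow]
  have hθ : hopWeight d ξ * ξ ^ 2 ≠ 0 := mul_ne_zero (hopWeight_pos hξ).ne' (pow_ne_zero 2 hξ.ne')
  calc ξ ^ d * (hopWeight d ξ * ξ ^ 2 * ξ⁻¹ ^ d * (hopWeight d ξ * ξ ^ 2)⁻¹)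
      = (ξ ^ d * ξ⁻¹ ^ d) * ((hopWeight d ξ * ξ ^ 2) * (hopWeight d ξ * ξ ^ 2)⁻¹) := by ring
    _ = 1 := by rw [h1, mul_inv_cancel₀ hθ, one_mul]

end Identification

end

end Literature.MathematicalPhysics.QuantumFieldTheory.Balaban1983to89.B3CxiPropagator
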